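import Literature.Topology.FourManifolds.GroupTrisections
import Summits.SmoothPoincare4.SmoothPoincare4.Theorems.ShadowsStandard.Negative.ShadowLevels
import Summits.SmoothPoincare4.SmoothPoincare4.Theorems.CongruenceShadowsShadowsStandardStubCentralizerFreeKernel
import Summits.SmoothPoincare4.SmoothPoincare4.Theorems.CongruenceShadowsShadowsStandardStubStdPairPrimitives
import Summits.SmoothPoincare4.SmoothPoincare4.Theorems.CongruenceShadowsShadowsStandardStubTrisectionPairPrimitivesZero
import Summits.SmoothPoincare4.SmoothPoincare4.Theorems.CongruenceShadowsShadowsStandardStubTrisectionPairPrimitivesSucc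
import Mathlib.GroupTheory.Index
import HarnessLib

/-!
# Effective centrelessness between two characteristic levels (line `finitary-ac-central-residue`,
crux `CongruenceShadows.ShadowsStandard`, item stmt-SmoothPoincare4-14593)

Let `S = S_{3+3m}` be the surface group, `N = s4Kernels.stabilizeIter m` the kernel triple of the
standard balanced trisection of `S⁴`, and let `B` be either the standard third kernel `N 2` or the
third kernel `K 2` of a slot-normalised `(3+3m; m+1)` group trisection `K = (N 0, N 1, K 2)` of the
trivial group.  **Effective centrelessness**: for every characteristic finite-index `M ≤ S` there
is a deeper characteristic finite-index `M' ≤ M` such that every element of `N 0` that is central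
in `N 0` modulo `B ⊔ M'` already lies in `B ⊔ M` (`stub_effectiveCentrelessStd`,
`stub_effectiveCentrelessTrisection`, the two registered stubs of the line proved here).  This is the plan's Stub 4 (`stub_effectiveCentreless`,
Lines/finitary-ac-central-residue.md), there routed through Melnikov's theorem on closed normal
subgroups of free profinite groups + compactness; here it is proved ELEMENTARILY from the four
landed stubs of the lead's reshape:

* `stub_centralizerFreeKernel` (K-free core): in a free group `F` on a finite alphabet, if
  `R ⊴ F` contains two distinct letters and `U ⊴ F` has finite index, some finite-index normal
  `V ≤ U` has the property that everything commuting with `R` modulo `V` lies in `U` (Magnus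
  quotient `(P → ι → 𝔽₃) ⋊ P`, `P = F ⧸ U`);
* `stub_stdPairPrimitives`, `stub_trisectionPairPrimitives_zero/_succ`: a free basis of `S ⧸ B`
  two of whose members lie in the image of `N 0` (explicit generators of `stabilizeIter`; the face
  character + Euclid at genus 3; Nielsen's normal form for generating tuples at genus ≥ 6);
* the glue `effectiveCentreless_of_primitives`: push to `F = S ⧸ B`, apply the core, and take the
  deeper level `M' = M ⊓ M_Q` with `M_Q` the verbal level of the finite quotient
  `Q = S ⧸ π⁻¹(V)` (characteristic by `Negative.levelSubgroup_characteristic`).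

Also recorded here, for the line's composition: the TWO-LEVEL RESIDUE LEMMA
(`residue_two_level`, `residue_two_level_eq`: with `N, A, B, M' ≤ M` normal, `B ≤ A N M'`,
`N ∩ B ≤ A M'` and effective centrelessness of `N` between `M'` and `M` relative to `A` give
`B ≤ A M`) and the transport of effective centrelessness along an automorphism fixing `N 0`
(`central_transport`). [folklore]
-/

-- the prescribed namespace `Summit.<P>.<Sub>.…` duplicates `SmoothPoincare4` (P = Sub)
set_option linter.dupNamespace false

noncomputable section

namespace Summit.SmoothPoincare4.SmoothPoincare4.Theorems.ShadowsStandard.FinitaryAcCentralResidue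

open Literature.Topology.FourManifolds Subgroup
open _root_.Summit.SmoothPoincare4.SmoothPoincare4.Theorems.ShadowsStandard.Negative
  (levelSubgroup levelSubgroup_quotient_le levelSubgroup_finiteIndex levelSubgroup_characteristic)
open _root_.Summit.SmoothPoincare4.SmoothPoincare4.Theorems.ShadowApproximation.EpiClassLivingston
  (stdKernel_normal)

/-! ## Small transport facts -/

/-- `e⁻¹` undoes `e` on subgroups. [folklore] -/
private theorem ec_map_map_symm {G : Type*} [Group G] (e : G ≃* G) (H : Subgroup G) :
    (H.map e.toMonoidHom).map e.symm.toMonoidHom = H := by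
  ext x
  simp

/-- If `e(H) = L` then `e⁻¹(L) = H`. [folklore] -/
private theorem ec_map_symm_of_map {G : Type*} [Group G] (e : G ≃* G) {H L : Subgroup G}
    (h : H.map e.toMonoidHom = L) : L.map e.symm.toMonoidHom = H := by
  rw [← h, ec_map_map_symm]

/-- A characteristic subgroup is fixed by every automorphism (as `map`). [folklore] -/
private theorem ec_map_char {G : Type*} [Group G] (e : G ≃* G) {M : Subgroup G}
    (hM : M.Characteristic) : M.map e.toMonoidHom = M :=
  (Subgroup.characteristic_iff_map_eq.mp hM) e

/-- The intersection of two characteristic subgroups is characteristic. [folklore] -/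
private theorem ec_characteristic_inf {G : Type*} [Group G] {H L : Subgroup G}
    (hH : H.Characteristic) (hL : L.Characteristic) : (H ⊓ L).Characteristic := by
  rw [Subgroup.characteristic_iff_comap_eq] at *
  intro ϕ
  rw [Subgroup.comap_inf, hH ϕ, hL ϕ]

/-! ## The two-level residue lemma -/

/-- **Residue lemma, two-level form, one inclusion.** With `N, A, B, M' ≤ M` normal: if
`B ≤ A ⊔ N ⊔ M'`, `N ⊓ B ≤ A ⊔ M'`, and every element of `N` that is central in `N` modulo `A ⊔ M'`
lies in `A ⊔ M`, then `B ≤ A ⊔ M`. [folklore] -/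
theorem residue_two_level {G : Type*} [Group G] (N A B M' M : Subgroup G)
    [N.Normal] [A.Normal] [B.Normal] [M'.Normal] [M.Normal]
    (hle : M' ≤ M) (hB : B ≤ A ⊔ N ⊔ M') (hNB : N ⊓ B ≤ A ⊔ M')
    (hZ : ∀ x ∈ N, (∀ y ∈ N, y * x * y⁻¹ * x⁻¹ ∈ A ⊔ M') → x ∈ A ⊔ M) :
    B ≤ A ⊔ M := by
  intro b hb
  have hb' : b ∈ N ⊔ (A ⊔ M') := by
    have : A ⊔ N ⊔ M' = N ⊔ (A ⊔ M') := by rw [sup_comm A N, sup_assoc]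
    exact this ▸ hB hb
  obtain ⟨n, hn, t, ht, rfl⟩ := (mem_sup_of_normal_left).1 hb'
  have hnA : n ∈ A ⊔ M := by
    refine hZ n hn fun y hy => ?_
    have hc : y * (n * t) * y⁻¹ * (n * t)⁻¹ ∈ A ⊔ M' := by
      apply hNB
      refine ⟨?_, ?_⟩
      · have h1 : (n * t) * y⁻¹ * (n * t)⁻¹ ∈ N :=
          Normal.conj_mem inferInstance y⁻¹ (N.inv_mem hy) (n * t)
        have := N.mul_mem hy h1
        simpa [mul_assoc] using this
      · have h1 : y * (n * t) * y⁻¹ ∈ B := Normal.conj_mem inferInstance (n * t) hb y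
        exact B.mul_mem h1 (B.inv_mem hb)
    have hd : n * (y * t * y⁻¹ * t⁻¹) * n⁻¹ ∈ A ⊔ M' := by
      have h1 : y * t * y⁻¹ ∈ A ⊔ M' := Normal.conj_mem inferInstance t ht y
      have h2 : y * t * y⁻¹ * t⁻¹ ∈ A ⊔ M' := (A ⊔ M').mul_mem h1 ((A ⊔ M').inv_mem ht)
      exact Normal.conj_mem inferInstance _ h2 n
    have key : y * n * y⁻¹ * n⁻¹ =
        (y * (n * t) * y⁻¹ * (n * t)⁻¹) * (n * (y * t * y⁻¹ * t⁻¹) * n⁻¹)⁻¹ := by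
      group
    rw [key]
    exact (A ⊔ M').mul_mem hc ((A ⊔ M').inv_mem hd)
  have ht' : t ∈ A ⊔ M := (sup_le_sup_left hle A) ht
  exact (A ⊔ M).mul_mem hnA ht'

/-- **Residue lemma, two-level symmetric form**: under the symmetric hypotheses, `A ⊔ M = B ⊔ M`.
[folklore] -/
theorem residue_two_level_eq {G : Type*} [Group G] (N A B M' M : Subgroup G)
    [N.Normal] [A.Normal] [B.Normal] [M'.Normal] [M.Normal]
    (hle : M' ≤ M)
    (hB : B ≤ A ⊔ N ⊔ M') (hA : A ≤ B ⊔ N ⊔ M')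
    (hNB : N ⊓ B ≤ A ⊔ M') (hNA : N ⊓ A ≤ B ⊔ M')
    (hZA : ∀ x ∈ N, (∀ y ∈ N, y * x * y⁻¹ * x⁻¹ ∈ A ⊔ M') → x ∈ A ⊔ M)
    (hZB : ∀ x ∈ N, (∀ y ∈ N, y * x * y⁻¹ * x⁻¹ ∈ B ⊔ M') → x ∈ B ⊔ M) :
    A ⊔ M = B ⊔ M :=
  le_antisymm (sup_le (residue_two_level N B A M' M hle hA hNA hZB) le_sup_right)
    (sup_le (residue_two_level N A B M' M hle hB hNB hZA) le_sup_right)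

/-! ## Transport along automorphisms -/

/-- **Transport of effective centrelessness** along an automorphism `e` fixing `N` (and the two
characteristic levels): the statement for `(N, A)` gives the statement for `(N, e(A))`.
[folklore] -/
theorem central_transport {G : Type*} [Group G] {N A M' M : Subgroup G} (e : G ≃* G)
    (heN : N.map e.toMonoidHom = N) (hM' : M'.Characteristic) (hM : M.Characteristic)
    (h : ∀ x ∈ N, (∀ y ∈ N, y * x * y⁻¹ * x⁻¹ ∈ A ⊔ M') → x ∈ A ⊔ M) :
    ∀ x ∈ N, (∀ y ∈ N, y * x * y⁻¹ * x⁻¹ ∈ A.map e.toMonoidHom ⊔ M') →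
      x ∈ A.map e.toMonoidHom ⊔ M := by
  intro x hx hyp
  have heN' : N.map e.symm.toMonoidHom = N := ec_map_symm_of_map e heN
  have hx' : e.symm x ∈ N := by
    rw [← heN']
    exact Subgroup.mem_map_of_mem _ hx
  have key : e.symm x ∈ A ⊔ M := by
    refine h _ hx' fun y hy => ?_
    have hy' : e y ∈ N := by
      rw [← heN]
      exact Subgroup.mem_map_of_mem _ hy
    have hc := hyp (e y) hy'
    have : e.symm (e y * x * (e y)⁻¹ * x⁻¹) ∈ (A.map e.toMonoidHom ⊔ M').map e.symm.toMonoidHom :=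
      Subgroup.mem_map_of_mem _ hc
    rw [Subgroup.map_sup, ec_map_map_symm, ec_map_char e.symm hM'] at this
    simpa using this
  have : e (e.symm x) ∈ (A ⊔ M).map e.toMonoidHom := Subgroup.mem_map_of_mem _ key
  rw [Subgroup.map_sup, ec_map_char e hM] at this
  simpa using this

/-! ## Effective centrelessness -/

/-- **Effective centrelessness between two levels**, from the free-group core and a basis of
`S ⧸ B` two of whose members lie in the image of `A`: for every characteristic finite-index `M`
there is a deeper characteristic finite-index `M' ≤ M` such that an element of `A` central in `A`
modulo `B ⊔ M'` lies in `B ⊔ M`.  The deeper level is `M ⊓ M_Q`, `M_Q` the verbal level of the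
finite quotient `Q = S ⧸ π⁻¹(V)`. [folklore] -/
theorem effectiveCentreless_of_primitives {m : ℕ} (A B : Subgroup (SurfaceGroup (3 + 3 * m)))
    [A.Normal] [B.Normal] {ι : Type} [Fintype ι] [DecidableEq ι]
    (e : FreeGroup ι ≃* SurfaceGroup (3 + 3 * m) ⧸ B) (a b : ι) (hab : a ≠ b)
    (ha : e (FreeGroup.of a) ∈ A.map (QuotientGroup.mk' B))
    (hb : e (FreeGroup.of b) ∈ A.map (QuotientGroup.mk' B))
    (M : Subgroup (SurfaceGroup (3 + 3 * m))) (hM : M.Characteristic) (hMf : M.FiniteIndex) :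
    ∃ M' : Subgroup (SurfaceGroup (3 + 3 * m)), M'.Characteristic ∧ M'.FiniteIndex ∧ M' ≤ M ∧
      ∀ x ∈ A, (∀ y ∈ A, y * x * y⁻¹ * x⁻¹ ∈ B ⊔ M') → x ∈ B ⊔ M := by
  haveI : M.Normal := by haveI := hM; infer_instance
  haveI := hMf
  -- the projection `π : S ↠ F`
  let π : SurfaceGroup (3 + 3 * m) →* FreeGroup ι := e.symm.toMonoidHom.comp (QuotientGroup.mk' B)
  have hπ : Function.Surjective π := e.symm.surjective.comp (QuotientGroup.mk'_surjective B)
  have hπker : ∀ x, π x = 1 ↔ x ∈ B := fun x => by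
    simp only [π, MonoidHom.coe_comp, MulEquiv.coe_toMonoidHom, Function.comp_apply,
      MulEquiv.map_eq_one_iff, QuotientGroup.mk'_apply, QuotientGroup.eq_one_iff]
  have hπe : ∀ w : FreeGroup ι, ∀ y, QuotientGroup.mk' B y = e w → π y = w := fun w y h => by
    simp only [π, MonoidHom.coe_comp, MulEquiv.coe_toMonoidHom, Function.comp_apply, h,
      MulEquiv.symm_apply_apply]
  let R : Subgroup (FreeGroup ι) := A.map π
  let U : Subgroup (FreeGroup ι) := M.map π
  haveI : R.Normal := Subgroup.Normal.map inferInstance π hπ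
  haveI : U.Normal := Subgroup.Normal.map inferInstance π hπ
  haveI : U.FiniteIndex :=
    ⟨fun h0 => hMf.index_ne_zero (Nat.eq_zero_of_zero_dvd (h0 ▸ M.index_map_dvd hπ))⟩
  have haR : FreeGroup.of a ∈ R := by
    obtain ⟨y, hy, hye⟩ := ha
    exact ⟨y, hy, hπe _ _ hye⟩
  have hbR : FreeGroup.of b ∈ R := by
    obtain ⟨y, hy, hye⟩ := hb
    exact ⟨y, hy, hπe _ _ hye⟩
  obtain ⟨V, hVn, hVf, _, hV⟩ := stub_centralizerFreeKernel R U a b hab haR hbR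
  haveI := hVn
  haveI := hVf
  -- the deeper level
  let L : Subgroup (SurfaceGroup (3 + 3 * m)) := V.comap π
  haveI hLn : L.Normal := Subgroup.Normal.comap inferInstance π
  haveI hLf : L.FiniteIndex :=
    ⟨by rw [Subgroup.index_comap_of_surjective _ hπ]; exact hVf.index_ne_zero⟩
  let M' : Subgroup (SurfaceGroup (3 + 3 * m)) :=
    M ⊓ levelSubgroup (3 + 3 * m) (SurfaceGroup (3 + 3 * m) ⧸ L)
  have hM'L : M' ≤ L := inf_le_right.trans (levelSubgroup_quotient_le L)
  haveI := levelSubgroup_finiteIndex (3 + 3 * m) (SurfaceGroup (3 + 3 * m) ⧸ L)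
  refine ⟨M', ec_characteristic_inf hM (levelSubgroup_characteristic _ _), inferInstance,
    inf_le_left, ?_⟩
  intro x hx hyp
  -- push the hypothesis to `F`
  have key : π x ∈ U := by
    refine hV (π x) fun y₀ hy₀ => ?_
    obtain ⟨y, hy, rfl⟩ := hy₀
    have h1 : y * x * y⁻¹ * x⁻¹ ∈ B ⊔ M' := hyp y hy
    have h2 : π (y * x * y⁻¹ * x⁻¹) ∈ (B ⊔ M').map π := Subgroup.mem_map_of_mem π h1
    rw [Subgroup.map_sup] at h2
    have hB : B.map π = ⊥ := by
      rw [eq_bot_iff]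
      rintro _ ⟨z, hz, rfl⟩
      exact (hπker z).2 hz
    have hM' : M'.map π ≤ V := by
      rintro _ ⟨z, hz, rfl⟩
      exact hM'L hz
    rw [hB, bot_sup_eq] at h2
    simpa only [map_mul, map_inv] using hM' h2
  -- and pull the conclusion back
  obtain ⟨z, hz, hzx⟩ := key
  have hzx' : π (z⁻¹ * x) = 1 := by rw [map_mul, map_inv, hzx, inv_mul_cancel]
  have hmem : z⁻¹ * x ∈ B := (hπker _).1 hzx'
  have : x = z * (z⁻¹ * x) := by group
  rw [this]
  exact (B ⊔ M).mul_mem (Subgroup.mem_sup_right hz) (Subgroup.mem_sup_left hmem)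

/-- **Effective centrelessness for the standard pair `(N 0, N 2)`** at every genus (registered
stub `stub_effectiveCentrelessStd` of line `finitary-ac-central-residue`): for every
characteristic finite-index `M ≤ S_{3+3m}` there is a deeper characteristic finite-index `M' ≤ M`
such that an element of `N 0` central in `N 0` modulo `N 2 ⊔ M'` lies in `N 2 ⊔ M`. [folklore] -/
theorem stub_effectiveCentrelessStd :
    ∀ (m : ℕ) (M : Subgroup (SurfaceGroup (3 + 3 * m))), M.Characteristic → M.FiniteIndex →
      ∃ M' : Subgroup (SurfaceGroup (3 + 3 * m)), M'.Characteristic ∧ M'.FiniteIndex ∧ M' ≤ M ∧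
        ∀ x ∈ s4Kernels.stabilizeIter m 0, (∀ y ∈ s4Kernels.stabilizeIter m 0,
          y * x * y⁻¹ * x⁻¹ ∈ s4Kernels.stabilizeIter m 2 ⊔ M') →
          x ∈ s4Kernels.stabilizeIter m 2 ⊔ M := by
  intro m M hM hMf
  obtain ⟨ι, _, _, e, a, b, hab, ha, hb⟩ := stub_stdPairPrimitives m
  exact effectiveCentreless_of_primitives _ _ e a b hab ha hb M hM hMf

/-- **Effective centrelessness for the trisection pair `(N 0, K 2)`** of a slot-normalised
`(3+3m; m+1)` group trisection `K = (N 0, N 1, K 2)` of the trivial group, at every genus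
(registered stub `stub_effectiveCentrelessTrisection`; genus `3`: face character + Euclid; genus
`≥ 6`: Nielsen normal form). [folklore] -/
theorem stub_effectiveCentrelessTrisection :
    ∀ (m : ℕ) (K : TrisectionKernels (3 + 3 * m)),
      IsGroupTrisection (3 + 3 * m) (m + 1) (PUnit : Type) K →
      K 0 = s4Kernels.stabilizeIter m 0 → K 1 = s4Kernels.stabilizeIter m 1 →
      ∀ M : Subgroup (SurfaceGroup (3 + 3 * m)), M.Characteristic → M.FiniteIndex →
      ∃ M' : Subgroup (SurfaceGroup (3 + 3 * m)), M'.Characteristic ∧ M'.FiniteIndex ∧ M' ≤ M ∧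
        ∀ x ∈ s4Kernels.stabilizeIter m 0, (∀ y ∈ s4Kernels.stabilizeIter m 0,
          y * x * y⁻¹ * x⁻¹ ∈ K 2 ⊔ M') → x ∈ K 2 ⊔ M := by
  intro m K hK h0 h1 M hM hMf
  haveI : (K 2).Normal := hK.normal 2
  cases m with
  | zero =>
    obtain ⟨ι, _, _, e, a, b, hab, ha, hb⟩ := stub_trisectionPairPrimitives_zero K hK h0 h1
    exact @effectiveCentreless_of_primitives 0 (s4Kernels.stabilizeIter 0 0) (K 2)
      (stdKernel_normal 0 0) inferInstance ι _ _ e a b hab ha hb M hM hMf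
  | succ n =>
    obtain ⟨ι, _, _, e, a, b, hab, ha, hb⟩ := stub_trisectionPairPrimitives_succ n K hK h0 h1
    exact effectiveCentreless_of_primitives _ _ e a b hab ha hb M hM hMf

end Summit.SmoothPoincare4.SmoothPoincare4.Theorems.ShadowsStandard.FinitaryAcCentralResidue

end
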